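import Summits.Ventures.PercRepro.C026MarkCalculus

/-!
# At most one cycle: the class, its invariance under the reduction steps, and the loop step (p6, gen 12)

Towards THEOREM U (`proofs/P6-unicyclic.md`: C-026 at every edge weight on every marked multigraph
with at most one cycle).  This file has the combinatorial half:

* **`AcyclicAway e₀`** — with the (at most one) edge of `e₀ : Option E` closed, no other closed edge
  has its endpoints joined; **`AtMostOneCycle`** — some `e₀` works (`none` = acyclic);
* the class is preserved by the steps of the calculus that change the graph: the live minor
  (`AtMostOneCycle.minor_bot`, through typer-2's `conn_embed_iff`) and the series step
  (`AtMostOneCycle.seriesGraph`, through typer-2's `IsSeries.conn_iff`); the parallel, pendant and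
  pendant-mark steps keep the graph;
* the loop step **R2**: killing a loop does not change the partition law
  (`law3_update_zero_of_loop`, `C026At_of_loop`).

The counting half (a terminal instance has ≤ 5 live vertices) and the induction are the next file.
-/

namespace PercRepro

open Finset

namespace MultiGraph

section LoopStep

variable {V E : Type} [Fintype E] [DecidableEq E]

/-- **A loop may be killed**: the partition law does not see the weight of a loop. -/
theorem law3_update_zero_of_loop {G : MultiGraph V E} {e : E} (he : G.fst e = G.snd e)
    (p : E → ℝ) (a b c : V) : G.law3 p a b c = G.law3 (Function.update p e 0) a b c := by
  funext s
  unfold law3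
  have hinv : PercRepro.flipEdge e ⁻¹' G.partitionEvent ![a, b, c] (rgs3 s) =
      G.partitionEvent ![a, b, c] (rgs3 s) := by
    ext ω
    show PercRepro.flipEdge e ω ∈ G.partitionEvent ![a, b, c] (rgs3 s) ↔
      ω ∈ G.partitionEvent ![a, b, c] (rgs3 s)
    simp only [partitionEvent, Set.mem_setOf_eq, PercRepro.flipEdge]
    exact forall_congr' fun i => forall_congr' fun j => by
      rw [G.conn_update_iff_of_loop he]
  rw [prob_split p e, prob_update_zero_eq_prob_update_one_preimage p e, hinv]
  ring

/-- **R2**: C-026 transports backwards along the killing of a loop. -/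
theorem C026At_of_loop {G : MultiGraph V E} {e : E} (he : G.fst e = G.snd e) {p : E → ℝ}
    {a b c : V} (h : G.C026At (Function.update p e 0) a b c) : G.C026At p a b c := by
  unfold C026At at h ⊢
  rw [law3_update_zero_of_loop he p a b c]
  exact h

end LoopStep

section AtMostOneCycle

variable {V E : Type*} (G : MultiGraph V E)

/-- **Acyclic away from `e₀`**: with the edge of `e₀` (if any) closed, no other closed edge has its
endpoints joined by open edges. -/
def AcyclicAway (e₀ : Option E) : Prop :=
  ∀ ω : Config E, (∀ f ∈ e₀, ω f = false) →
    ∀ e, some e ≠ e₀ → ω e = false → ¬ G.Conn ω (G.fst e) (G.snd e)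

/-- **At most one cycle**: `G` is acyclic away from some (at most one) edge. -/
def AtMostOneCycle : Prop := ∃ e₀ : Option E, G.AcyclicAway e₀

variable {G}

/-- An acyclic multigraph has at most one cycle. -/
theorem Acyclic.atMostOneCycle (h : G.Acyclic) : G.AtMostOneCycle :=
  ⟨none, fun ω _ e _ he => h ω e he⟩

/-! ### Invariance under the live minor -/

/-- **Deleting edges keeps at most one cycle**: the minor `G.minor u ⊥` (the edges outside `u`
deleted, nothing contracted) is acyclic away from the image of `e₀`. -/
theorem AtMostOneCycle.minor_bot (h : G.AtMostOneCycle) (u : Config E) :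
    (G.minor u ⊥).AtMostOneCycle := by
  classical
  obtain ⟨e₀, h⟩ := h
  refine ⟨e₀.bind fun f => if hf : (⊥ : Config E) f = false ∧ u f = true then some ⟨f, hf⟩
    else none, ?_⟩
  intro σ hσ e he hσe hconn
  have hconn' : G.Conn (embed u ⊥ σ) (G.fst e.1) (G.snd e.1) :=
    (G.conn_embed_iff u ⊥ σ _ _).mpr hconn
  refine h (embed u ⊥ σ) ?_ e.1 ?_ ?_ hconn'
  · intro f hf
    rw [Option.mem_def] at hf
    by_cases hfu : (⊥ : Config E) f = false ∧ u f = true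
    · have hmem : (⟨f, hfu⟩ : Face u ⊥) ∈ e₀.bind fun f =>
          if hf : (⊥ : Config E) f = false ∧ u f = true then some ⟨f, hf⟩ else none := by
        rw [Option.mem_def, hf]
        simp [hfu]
      rw [embed_apply_of_mem u ⊥ σ hfu]
      exact hσ _ hmem
    · rw [embed_apply_of_not u ⊥ σ hfu]
      rfl
  · intro heq
    apply he
    rw [← heq]
    simp [e.2]
  · rw [embed_apply_of_mem u ⊥ σ e.2]
    exact hσe

end AtMostOneCycle

/-! ### Invariance under the series step -/

section SeriesInvariance

variable {V E : Type*} [DecidableEq E] {G : MultiGraph V E} {e₁ e₂ : E} {x y z : V}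

/-- In the series graph the only edge at `x` is `e₂`. -/
theorem IsSeries.seriesGraph_edgeAt (hs : G.IsSeries e₁ e₂ x y z) {e : E}
    (he : (G.seriesGraph e₁ y z).fst e = x ∨ (G.seriesGraph e₁ y z).snd e = x) : e = e₂ := by
  by_cases h₁ : e = e₁
  · subst h₁
    rw [G.seriesGraph_fst_self, G.seriesGraph_snd_self] at he
    rcases he with h | h
    · exact absurd h hs.yx
    · exact absurd h hs.zx
  · rw [G.seriesGraph_fst_of_ne h₁, G.seriesGraph_snd_of_ne h₁] at he
    rcases hs.deg e he with h | h
    · exact absurd h h₁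
    · exact h

/-- The endpoints of an edge other than `e₂` of the series graph are not `x`. -/
theorem IsSeries.seriesGraph_ends_ne (hs : G.IsSeries e₁ e₂ x y z) {e : E} (he : e ≠ e₂) :
    (G.seriesGraph e₁ y z).fst e ≠ x ∧ (G.seriesGraph e₁ y z).snd e ≠ x :=
  ⟨fun h => he (hs.seriesGraph_edgeAt (Or.inl h)), fun h => he (hs.seriesGraph_edgeAt (Or.inr h))⟩

/-- `x` is pendant at `z` in the series graph. -/
theorem IsSeries.seriesGraph_pendant (hs : G.IsSeries e₁ e₂ x y z) :
    (G.seriesGraph e₁ y z).Pendant x z := by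
  refine ⟨fun e he => ?_, ⟨e₂, ?_⟩⟩
  · have he' : (G.seriesGraph e₁ y z).fst e = x ∨ (G.seriesGraph e₁ y z).snd e = x := by
      simpa [edgesAt] using he
    rw [hs.seriesGraph_edgeAt he', G.seriesGraph_fst_of_ne hs.ne.symm,
      G.seriesGraph_snd_of_ne hs.ne.symm]
    exact hs.end₂
  · have hne : e₂ ≠ e₁ := hs.ne.symm
    simp only [edgesAt, Set.mem_setOf_eq, Set.mem_singleton_iff, G.seriesGraph_fst_of_ne hne,
      G.seriesGraph_snd_of_ne hne]
    rcases hs.end₂ with ⟨h, _⟩ | ⟨_, h⟩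
    · exact Or.inl h
    · exact Or.inr h

/-- A configuration of the series graph with `e₂` closed is a reduced configuration of `G`. -/
theorem serConfig_update_true (hne : e₁ ≠ e₂) (ω' : Config E) (h₂ : ω' e₂ = false) :
    serConfig e₁ e₂ (Function.update ω' e₂ true) = ω' := by
  funext e
  by_cases h1 : e = e₁
  · rw [h1, serConfig_apply_fst, Function.update_of_ne hne, Function.update_self, Bool.and_true]
  · by_cases h2 : e = e₂
    · rw [h2, serConfig_apply_snd hne, h₂]
    · rw [serConfig_apply_of_ne _ h1 h2, Function.update_of_ne h2]

omit [DecidableEq E] in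
/-- With `e₁` and `e₂` closed, `x` is isolated in `G`. -/
theorem IsSeries.isolated_of_closed (hs : G.IsSeries e₁ e₂ x y z) {ω : Config E}
    (h₁ : ω e₁ = false) (h₂ : ω e₂ = false) : ∀ e, ω e = true → G.fst e ≠ x ∧ G.snd e ≠ x := by
  intro e he
  refine ⟨fun h => ?_, fun h => ?_⟩
  · rcases hs.deg e (Or.inl h) with rfl | rfl
    · rw [h₁] at he; exact absurd he (by decide)
    · rw [h₂] at he; exact absurd he (by decide)
  · rcases hs.deg e (Or.inr h) with rfl | rfl
    · rw [h₁] at he; exact absurd he (by decide)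
    · rw [h₂] at he; exact absurd he (by decide)

/-- With `e₁` closed, opening `e₂` joins `x` to `z` only: connectivity between vertices other than
`x` is unchanged. -/
theorem IsSeries.conn_update_e₂_iff (hs : G.IsSeries e₁ e₂ x y z) {ω : Config E}
    (h₁ : ω e₁ = false) (h₂ : ω e₂ = false) {u w : V} (hu : u ≠ x) (hw : w ≠ x) :
    G.Conn (Function.update ω e₂ true) u w ↔ G.Conn ω u w := by
  rw [G.conn_update_true_iff]
  have hiso := hs.isolated_of_closed h₁ h₂
  have hx : ∀ v, v ≠ x → ¬ G.Conn ω v x := fun v hv h => hv (eq_of_conn_of_isolated hiso h.symm)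
  have hx' : ∀ v, v ≠ x → ¬ G.Conn ω x v := fun v hv h => hv (eq_of_conn_of_isolated hiso h)
  constructor
  · rintro (h | ⟨h1, h2⟩ | ⟨h1, h2⟩)
    · exact h
    · rcases hs.end₂ with ⟨hf, -⟩ | ⟨-, hsn⟩
      · rw [hf] at h1
        exact absurd h1 (hx u hu)
      · rw [hsn] at h2
        exact absurd h2 (hx' w hw)
    · rcases hs.end₂ with ⟨hf, -⟩ | ⟨-, hsn⟩
      · rw [hf] at h2
        exact absurd h2 (hx' w hw)
      · rw [hsn] at h1
        exact absurd h1 (hx u hu)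
  · exact Or.inl

/-- `e₂` is an edge at `x` in the series graph. -/
theorem IsSeries.e₂_mem_edgesAt (hs : G.IsSeries e₁ e₂ x y z) :
    e₂ ∈ (G.seriesGraph e₁ y z).edgesAt ({x} : Set V) := by
  have hne : e₂ ≠ e₁ := hs.ne.symm
  simp only [edgesAt, Set.mem_setOf_eq, Set.mem_singleton_iff, G.seriesGraph_fst_of_ne hne,
    G.seriesGraph_snd_of_ne hne]
  rcases hs.end₂ with ⟨h, _⟩ | ⟨_, h⟩
  · exact Or.inl h
  · exact Or.inr h

/-- An edge other than `e₂` is not at `x` in the series graph. -/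
theorem IsSeries.notMem_edgesAt_of_ne (hs : G.IsSeries e₁ e₂ x y z) {f : E} (hf : f ≠ e₂) :
    f ∉ (G.seriesGraph e₁ y z).edgesAt ({x} : Set V) := by
  intro hmem
  have : (G.seriesGraph e₁ y z).fst f = x ∨ (G.seriesGraph e₁ y z).snd f = x := by
    simpa [edgesAt] using hmem
  exact hf (hs.seriesGraph_edgeAt this)

omit [DecidableEq E] in
/-- An edge other than `e₁, e₂` has neither endpoint at `x`. -/
theorem IsSeries.ends_ne_of_ne (hs : G.IsSeries e₁ e₂ x y z) {e : E} (h₁ : e ≠ e₁) (h₂ : e ≠ e₂) :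
    G.fst e ≠ x ∧ G.snd e ≠ x := by
  constructor
  · intro h
    rcases hs.deg e (Or.inl h) with h' | h'
    · exact h₁ h'
    · exact h₂ h'
  · intro h
    rcases hs.deg e (Or.inr h) with h' | h'
    · exact h₁ h'
    · exact h₂ h'

/-- **The series step keeps at most one cycle**: the series graph is acyclic away from `e₀`, or
from `e₁` when `e₀` was `e₂` (the path `y–x–z` became the edge `e₁ = y–z`). -/
theorem AtMostOneCycle.seriesGraph (hG : G.AtMostOneCycle) (hs : G.IsSeries e₁ e₂ x y z) :
    (G.seriesGraph e₁ y z).AtMostOneCycle := by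
  obtain ⟨e₀, h⟩ := hG
  refine ⟨if e₀ = some e₂ then some e₁ else e₀, ?_⟩
  intro ω' hω' e he hωe hc
  by_cases he₂ : e = e₂
  · subst he₂
    have hiso : ∀ f, ω' f = true →
        (G.seriesGraph e₁ y z).fst f ≠ x ∧ (G.seriesGraph e₁ y z).snd f ≠ x := by
      intro f hf
      have hfe : f ≠ e := fun hh => by
        rw [hh, hωe] at hf
        exact absurd hf (by decide)
      exact hs.seriesGraph_ends_ne hfe
    rw [G.seriesGraph_fst_of_ne hs.ne.symm, G.seriesGraph_snd_of_ne hs.ne.symm] at hc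
    rcases hs.end₂ with ⟨hf, hsn⟩ | ⟨hf, hsn⟩
    · rw [hf, hsn] at hc
      exact hs.zx (eq_of_conn_of_isolated hiso hc)
    · rw [hf, hsn] at hc
      exact hs.zx (eq_of_conn_of_isolated hiso hc.symm)
  · have hends := hs.seriesGraph_ends_ne he₂
    have hpend := hs.seriesGraph_pendant
    have hc'' : (G.seriesGraph e₁ y z).Conn ((G.seriesGraph e₁ y z).closeStar x ω')
        ((G.seriesGraph e₁ y z).fst e) ((G.seriesGraph e₁ y z).snd e) :=
      ((G.seriesGraph e₁ y z).conn_closeStar_iff hpend hs.zx.symm hends.1 hends.2).mp hc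
    set ω'' := (G.seriesGraph e₁ y z).closeStar x ω' with hω''
    have hω''e₂ : ω'' e₂ = false :=
      (G.seriesGraph e₁ y z).closeStar_apply_of_mem hs.e₂_mem_edgesAt
    have hω''_of_ne : ∀ f, f ≠ e₂ → ω'' f = ω' f := fun f hf =>
      (G.seriesGraph e₁ y z).closeStar_apply_of_notMem (hs.notMem_edgesAt_of_ne hf)
    have hser : serConfig e₁ e₂ (Function.update ω'' e₂ true) = ω'' :=
      serConfig_update_true hs.ne ω'' hω''e₂
    have hcG : G.Conn (Function.update ω'' e₂ true) ((G.seriesGraph e₁ y z).fst e)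
        ((G.seriesGraph e₁ y z).snd e) := by
      rw [hs.conn_iff _ hends.1 hends.2, hser]
      exact hc''
    by_cases he₁ : e = e₁
    · subst he₁
      have hne₂ : e₀ ≠ some e₂ := fun hh => he (by rw [if_pos hh])
      have hne₁ : some e ≠ e₀ := by
        intro hh
        apply he
        rw [if_neg hne₂]
        exact hh
      rw [G.seriesGraph_fst_self, G.seriesGraph_snd_self] at hcG
      have hxz : G.Conn (Function.update ω'' e₂ true) x z := by
        rcases hs.end₂ with ⟨hf, hsn⟩ | ⟨hf, hsn⟩
        · exact Conn.of_openAdj ⟨e₂, Function.update_self _ _ _, Or.inl ⟨hf, hsn⟩⟩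
        · exact Conn.of_openAdj ⟨e₂, Function.update_self _ _ _, Or.inr ⟨hf, hsn⟩⟩
      have hxy : G.Conn (Function.update ω'' e₂ true) x y := hxz.trans hcG.symm
      have hconn₁ : G.Conn (Function.update ω'' e₂ true) (G.fst e) (G.snd e) := by
        rcases hs.end₁ with ⟨hf, hsn⟩ | ⟨hf, hsn⟩
        · rw [hf, hsn]
          exact hxy.symm
        · rw [hf, hsn]
          exact hxy
      refine h _ ?_ e hne₁ ?_ hconn₁
      · intro f hf
        have hfe₂ : f ≠ e₂ := fun hh => hne₂ (by rw [Option.mem_def] at hf; rw [hf, hh])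
        rw [Function.update_of_ne hfe₂, hω''_of_ne f hfe₂]
        apply hω' f
        rw [if_neg hne₂]
        exact hf
      · rw [Function.update_of_ne hs.ne, hω''_of_ne e hs.ne]
        exact hωe
    · rw [G.seriesGraph_fst_of_ne he₁, G.seriesGraph_snd_of_ne he₁] at hcG
      have hendsG := hs.ends_ne_of_ne he₁ he₂
      by_cases h₀ : e₀ = some e₂
      · have hω'e₁ : ω' e₁ = false := hω' e₁ (by rw [if_pos h₀]; rfl)
        have hω''e₁ : ω'' e₁ = false := by
          rw [hω''_of_ne e₁ hs.ne]
          exact hω'e₁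
        have hcG' : G.Conn ω'' (G.fst e) (G.snd e) := by
          rw [← hs.conn_update_e₂_iff hω''e₁ hω''e₂ hendsG.1 hendsG.2]
          exact hcG
        refine h ω'' ?_ e ?_ ?_ hcG'
        · intro f hf
          rw [Option.mem_def, h₀] at hf
          rw [← Option.some.inj hf]
          exact hω''e₂
        · rw [h₀]
          intro hh
          exact he₂ (Option.some.inj hh)
        · rw [hω''_of_ne e he₂]
          exact hωe
      · refine h _ ?_ e ?_ ?_ hcG
        · intro f hf
          have hfe₂ : f ≠ e₂ := fun hh => h₀ (by rw [Option.mem_def] at hf; rw [hf, hh])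
          rw [Function.update_of_ne hfe₂, hω''_of_ne f hfe₂]
          apply hω' f
          rw [if_neg h₀]
          exact hf
        · rw [if_neg h₀] at he
          exact he
        · rw [Function.update_of_ne he₂, hω''_of_ne e he₂]
          exact hωe

end SeriesInvariance

end MultiGraph

end PercRepro
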